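import Summits.AtomisticToContinuum.BoseEinsteinCondensation.Theorems.BECThomsonPrincipleFibreConductanceFlatteningDefs
import Summits.AtomisticToContinuum.BoseEinsteinCondensation.Theorems.BECThomsonPrincipleFibreConductanceStubLineFubini
import Summits.AtomisticToContinuum.BoseEinsteinCondensation.Theorems.BECThomsonPrincipleFibreConductanceStubFlatFlowDiv
import Summits.AtomisticToContinuum.BoseEinsteinCondensation.Theorems.BECThomsonPrincipleFibreConductanceStubFlatFlowCost
import Summits.AtomisticToContinuum.BoseEinsteinCondensation.Theorems.BECThomsonPrincipleFibreConductanceStubLineMoments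
import Summits.AtomisticToContinuum.BoseEinsteinCondensation.Theorems.BECThomsonPrincipleFibreConductanceStubTransport
import Summits.AtomisticToContinuum.BoseEinsteinCondensation.Theorems.BECThomsonPrincipleFibreConductanceStubParsevalShell
import HarnessLib

/-!
# Line `parseval-shell-bootstrap` for crux `BECThomsonPrinciple.FibreConductance`
(stmt-AtomisticToContinuum-9480) — lead's working skeleton (r4, lead c3, 2026-08-16)

**Reshape r3 → r4 (same composition idea: transport + two correctors).** The density channel no
longer goes through `stub_densityFlattening` (`E_W D² ≤ KL²`, whose proof needs infrared screening
of the density channel) and `stub_betaCorrector`; it goes through the gen-1 line's LANDED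
`stub_betaHolder : DensityFlatteningCubic → ShellOccupation → BetaCorrectorBound` and the
deterministic flattening chain of `Theorems/BECThomsonPrincipleFibreConductanceFlatteningDefs.lean`
(p121991): `stub_lineFubini`, `stub_flatFlowDiv`, `stub_flatFlowCost`, `stub_lineMoments`, whose
composition `densityFlatteningCubic_of` turns the SHARED k-free landscape input
`ConditionalDensityMoments` (`stub_conditionalDensityMoments`, verbatim the gen-1 / c2 stub) into
`DensityFlatteningCubic`. Vocabulary and the other landed pieces: `Theorems/BECThomsonPrincipleDefs.lean`
(p74561: `stub_compose`, `gradientCorrectorBound_of`), `…StubTransport` (p88851), `…StubParsevalShell`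
(p88803), `…CageDefs` / `…StubBetaHolder` (gen 1).

Registered stubs (7): `stub_lineFubini` (det., LANDED p122731), `stub_flatFlowDiv` (det., the lead's,
LANDED p122755), `stub_flatFlowCost` (det., LANDED p123024), `stub_lineMoments` (det., LANDED p123473),
`stub_conditionalDensityMoments` (OPEN, shared landscape input), `stub_gradientComparability` (OPEN,
landscape, gradient channel), `stub_shellOccupation` (OPEN, HARDEST, the infrared input; crux-sized by
`infraredNecessity` p90785). Status r4 (2026-08-16T19:45Z): the whole deterministic content of the line
is in the tree; this file = the three OPEN inputs as `sorry`s + the closing theorem.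
-/

noncomputable section

namespace Summit.AtomisticToContinuum.BoseEinsteinCondensation.Cruxes.FibreConductance.ParsevalShellBootstrap

open MeasureTheory
open scoped ENNReal
open Literature.MathematicalPhysics.QuantumManyBody.BoseGas
open Summit.AtomisticToContinuum.BoseEinsteinCondensation.Theses.BECThomsonPrinciple (FibreConductance)
open Summit.AtomisticToContinuum.BoseEinsteinCondensation.Cruxes.FibreConductance.TaggedPathHarnack
  (ConditionalDensityMoments DensityFlatteningCubic stub_betaHolder)

/-! ## Registered stubs — deterministic flattening chain (all LANDED; the theorems `stub_lineFubini`,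
`stub_flatFlowDiv`, `stub_flatFlowCost`, `stub_lineMoments` are imported from their files) -/

/-! ## Registered stubs — open inputs (landscape ×2, infrared ×1) -/

/-- **Stub 5'** (OPEN; the shared k-free landscape input of the lines tagged-path-harnack /
conditional-law-poincare, verbatim): two-sided uniform-location moments of `g = L³ψ²`. -/
theorem stub_conditionalDensityMoments : Goal.stub_conditionalDensityMoments := by
  sorry

/-- **Stub 4** (OPEN; L/XL, landscape half, oscillating charge): see `GradientComparability`. -/
theorem stub_gradientComparability : Goal.stub_gradientComparability := by
  sorry

/-- **Stub 6** (OPEN; XL, HARDEST, the infrared input at minimal strength): see `ShellOccupation`. -/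
theorem stub_shellOccupation : Goal.stub_shellOccupation := by
  sorry

/-! ## Composition -/

/-- **The crux from the registered stubs, BY NAME**: transport (`stub_transport`, landed) + gradient
corrector (`gradientCorrectorBound_of` of `stub_gradientComparability` and `stub_parsevalShell
stub_shellOccupation`, landed glue) + β-corrector by Hölder (`stub_betaHolder`, landed) fed by the
flattening chain (`densityFlatteningCubic_of`, landed composition) and `stub_shellOccupation`. -/
theorem fibreConductance_of_registered_stubs : FibreConductance :=
  stub_transport
    (gradientCorrectorBound_of stub_gradientComparability (stub_parsevalShell stub_shellOccupation))
    (stub_betaHolder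
      (densityFlatteningCubic_of stub_lineFubini stub_flatFlowDiv stub_flatFlowCost stub_lineMoments
        stub_conditionalDensityMoments)
      stub_shellOccupation)

end Summit.AtomisticToContinuum.BoseEinsteinCondensation.Cruxes.FibreConductance.ParsevalShellBootstrap

end
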